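import Literature.Barriers.RiemannHypothesis.RamanujanAxiomNecessity

/-!
# Ramanujan-axiom necessity — the weak-Ramanujan carrier `Q_{χ,b}` (companion record)

Selberg's axioms (1),(2),(3),(5) with a POLYNOMIAL Euler product of Selberg defect
`θ = 1/4 + b/2 ∈ (1/4, 1/2)` do NOT force zeros onto the line: the quadratic lift
`Q_{χ,b}(s) = L(2s − 1/2 − b, χ) · L(2s − 1/2 + b, χ)` (`χ` odd real primitive, `0 < b < 1/2`) satisfies
(1),(2),(3) [𝒮♯] and (5) with local degree 4 and defect `1/4 + b/2`, violates only (4) (`|a(p²)| ≥ p^{1/2+b}`),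
and vanishes at `1/2 ± b/2 + iγ/2` for every critical-line zero `1/2 + iγ` of `L(s, χ)` (hypothesis `hz`,
explicit in every theorem; for `χ₋₄`, `γ₁ = 6.0209…` is rigorously verified [cite: Rumely1993ERH, Table]).
This answers scope caveat (a) of `RamanujanAxiomNecessity` NEGATIVELY on `(1/4, 1/2)`; residual (a″): `θ ≤ 1/4`
at any degree (the class then contains `ζ`, so any such statement is RiemannHypothesis-strength) and degrees
`2 ≤ d < 4` [cite: KaczorowskiSelbergClass2006, §2.1 axioms (1)–(5), p. 156]. Source: W-06 cycle 2, cell C2′,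
rh-idea-3 g12 MAIN rev b 02a9eb04f2839b13 PART A + B (PART C — typed candidates T2–T4 over unconstructed
data — stays pub bytes); critic rh-split-ref-2 g11 THEOREM-GRADE 2026-08-29T00:50:20Z; desk rh-split-ref g15
00:55:46Z / 01:03:14Z. Nothing here bears on the truth of RH.
-/

noncomputable section

open Complex Filter Topology Asymptotics
open scoped ComplexConjugate Real

namespace Literature.Barriers.RiemannHypothesis.RamanujanAxiom.WeakCarrier

open Literature.Barriers.RiemannHypothesis
open Literature.Barriers.RiemannHypothesis.RamanujanAxiom
open Literature.NumberTheory.LFunctions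

variable {N : ℕ} [NeZero N]

/-! ## PART A · the quadratic lift and the weak-Ramanujan carrier -/

/-- The quadratic lift `(𝓛F)(s) = F(2s − 1/2)`. [folklore] -/
def quadLift (F : ℂ → ℂ) (s : ℂ) : ℂ := F (2 * s - 1 / 2)

/-- Square-support lift of a coefficient sequence: `(𝓛f)(m²) = f(m) √m`, `0` off the squares
(so that `∑ (𝓛f)(n) n^{−s} = ∑ f(m) m^{−(2s − 1/2)}`). [folklore] -/
def liftSq (f : ℕ → ℂ) (n : ℕ) : ℂ :=
  if Nat.sqrt n * Nat.sqrt n = n then f (Nat.sqrt n) * (Real.sqrt (Nat.sqrt n) : ℂ) else 0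

/-- **The weak-Ramanujan carrier** `Q_{χ,b}(s) = L(2s − 1/2 − b, χ) L(2s − 1/2 + b, χ̄)`. [folklore] -/
def weakCarrier (χ : DirichletCharacter ℂ N) (b : ℝ) : ℂ → ℂ := quadLift (shiftedL χ b)

/-- Transport helper (analytic bookkeeping for the lift `s ↦ 2s − 1/2`). [folklore] -/
private theorem weakCarrier_apply (χ : DirichletCharacter ℂ N) (b : ℝ) (s : ℂ) :
    weakCarrier χ b s = χ.LFunction (2 * s - 1 / 2 - b) * χ⁻¹.LFunction (2 * s - 1 / 2 + b) := rfl

/-- Its Dirichlet coefficients `a(m²) = c_{χ,b}(m) √m`, `c_{χ,b} = shiftedLCoeff χ b`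
(`= χ(m) m^{−b} σ_{2b}(m)` for real `χ`; integers iff `b = 1/2`). [folklore] -/
def weakCarrierCoeff (χ : DirichletCharacter ℂ N) (b : ℝ) : ℕ → ℂ := liftSq ⇑(shiftedLCoeff χ b)

/-- **A critical-line zero `1/2 + it` of `L(s, χ)` gives the zero `1/2 + b/2 + it/2` of `Q_{χ,b}`.** [cite: Rumely1993ERH, Table] -/
theorem weakCarrier_eq_zero (hN : N ≠ 1) {χ : DirichletCharacter ℂ N} (hχ : χ ≠ 1) (b : ℝ)
    {t : ℝ} (h : χ.LFunction (1 / 2 + t * I) = 0) :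
    weakCarrier χ b (1 / 2 + b / 2 + t / 2 * I) = 0 := by
  have h0 := (shiftedL_eq_zero_of_LFunction_eq_zero hN hχ b h).1
  rw [weakCarrier, quadLift,
    show (2 * (1 / 2 + (b : ℂ) / 2 + (t : ℂ) / 2 * I) - 1 / 2 : ℂ) = 1 / 2 + (b : ℂ) + t * I by ring]
  exact h0

/-- Its real part is `1/2 + b/2` — inside the open strip, OFF the line for `0 < b < 1/2`. [folklore] -/
private theorem weakCarrier_zero_re (b t : ℝ) : (1 / 2 + (b : ℂ) / 2 + (t : ℂ) / 2 * I).re = 1 / 2 + b / 2 := by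
  simp

/-- **Any non-tempered Selberg datum carrying `Q_{χ,b}` violates the strip Riemann hypothesis**, as
soon as `L(s, χ)` has one critical-line zero (hypothesis `hz`, exactly as in the tree's
`not_stripRiemannHypothesis_shiftedL`). [cite: Rumely1993ERH, Table] -/
theorem not_stripRiemannHypothesis_weakCarrier {χ : DirichletCharacter ℂ N} (hχ : χ ≠ 1) {b : ℝ}
    (hb0 : 0 < b) (hb : b < 1 / 2) (D : NontemperedSelbergDatum) (hD : D.toFun = weakCarrier χ b)
    (hz : ∃ t : ℝ, χ.LFunction (1 / 2 + t * I) = 0) : ¬ D.StripRiemannHypothesis := by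
  have hN : N ≠ 1 := by
    rintro rfl
    exact hχ (Subsingleton.elim _ _)
  obtain ⟨t, ht⟩ := hz
  intro hRH
  have h0 := weakCarrier_eq_zero hN hχ b ht
  have := hRH (1 / 2 + b / 2 + t / 2 * I) (by rw [hD]; exact h0) (by simp; linarith)
    (by simp; linarith)
  simp at this
  linarith

/-- **The weak-Ramanujan class `𝒲`** = Selberg's axioms (1) (abscissa `≤ 1`), (2) (polar polynomial
a power of `X − 1`), (3) WITH `re μ_j ≥ 0`, (5) (Selberg's form, `θ < 1/2`, a field of the
structure) — everything except (4) Ramanujan. [cite: KaczorowskiSelbergClass2006, §2.1 axioms (1)–(5), p. 156] -/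
def WeakRamanujanClass (D : NontemperedSelbergDatum) : Prop :=
  D.abscissa ≤ 1 ∧ (∃ m : ℕ, D.polar = (Polynomial.X - Polynomial.C 1) ^ m) ∧ ∀ j, 0 ≤ (D.mu j).re

/-- **T1 = scope caveat (a) as a statement**: «𝒲 forces the strip RH». [cite: KaczorowskiSelbergClass2006, §2.1 axioms (1)–(5), p. 156] -/
def WeakRamanujanClassForcesLine : Prop :=
  ∀ D : NontemperedSelbergDatum, WeakRamanujanClass D → D.StripRiemannHypothesis

/-- Datum-existence statement for `Q_{χ,b}` (proved in PART B for odd real primitive `χ`). [cite: KaczorowskiSelbergClass2006, §2.1 axioms (1)–(5), p. 156] -/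
def WeakCarrierDatum (χ : DirichletCharacter ℂ N) (b : ℝ) : Prop :=
  ∃ D : NontemperedSelbergDatum, D.toFun = weakCarrier χ b ∧ D.coeff = weakCarrierCoeff χ b ∧
    D.abscissa = 3 / 4 + b / 2 ∧ D.polar = 1 ∧ D.Q = ((N : ℝ) / π) ^ 2 ∧ D.numGamma = 2 ∧
    D.rootNumber = 1 ∧ (∀ j, D.lam j = 1) ∧ ∀ j, 0 ≤ (D.mu j).re

/-- **Caveat (a), negative (from the datum statement).** [cite: Rumely1993ERH, Table] -/
theorem not_weakRamanujanClassForcesLine_of {χ : DirichletCharacter ℂ N} (hχ : χ ≠ 1) {b : ℝ}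
    (hb0 : 0 < b) (hb : b < 1 / 2) (hex : WeakCarrierDatum χ b)
    (hz : ∃ t : ℝ, χ.LFunction (1 / 2 + t * I) = 0) : ¬ WeakRamanujanClassForcesLine := by
  obtain ⟨D, hF, -, habs, hpol, -, -, -, -, hmu⟩ := hex
  intro h
  refine not_stripRiemannHypothesis_weakCarrier hχ hb0 hb D hF hz (h D ⟨?_, ⟨0, ?_⟩, hmu⟩)
  · rw [habs]; linarith
  · rw [hpol, pow_zero]

/-! ## PART B · the datum (transport along `s ↦ 2s − 1/2`) -/

/-- Transport helper (analytic bookkeeping for the lift `s ↦ 2s − 1/2`). [folklore] -/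
private theorem liftSq_mul_self (f : ℕ → ℂ) (m : ℕ) : liftSq f (m * m) = f m * (Real.sqrt m : ℂ) := by
  simp [liftSq, Nat.sqrt_eq]

/-- Transport helper (analytic bookkeeping for the lift `s ↦ 2s − 1/2`). [folklore] -/
private theorem liftSq_of_not_mem_range {f : ℕ → ℂ} {n : ℕ} (hn : n ∉ Set.range (fun m : ℕ ↦ m * m)) :
    liftSq f n = 0 := by
  simp only [liftSq]
  rw [if_neg]
  exact fun h ↦ hn ⟨Nat.sqrt n, h⟩

/-- Transport helper (analytic bookkeeping for the lift `s ↦ 2s − 1/2`). [folklore] -/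
private theorem natCast_mul_self_cpow (m : ℕ) (s : ℂ) :
    ((m * m : ℕ) : ℂ) ^ s = (m : ℂ) ^ s * (m : ℂ) ^ s := by
  rw [Nat.cast_mul, ← Complex.ofReal_natCast,
    Complex.mul_cpow_ofReal_nonneg (Nat.cast_nonneg m) (Nat.cast_nonneg m)]

/-- Transport helper (analytic bookkeeping for the lift `s ↦ 2s − 1/2`). [folklore] -/
private theorem cpow_two_mul' (x : ℂ) (s : ℂ) : x ^ (2 * s) = x ^ s * x ^ s := by
  rw [show (2 : ℂ) * s = ((2 : ℕ) : ℂ) * s by norm_num, Complex.cpow_nat_mul, sq]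

/-- Transport helper (analytic bookkeeping for the lift `s ↦ 2s − 1/2`). [folklore] -/
private theorem ofReal_sqrt_eq_cpow {x : ℝ} (hx : 0 ≤ x) : (Real.sqrt x : ℂ) = (x : ℂ) ^ ((1 : ℂ) / 2) := by
  rw [Real.sqrt_eq_rpow, Complex.ofReal_cpow hx]
  norm_num

/-- The term identity behind the lift: `(𝓛f)(m²) (m²)^{−s} = f(m) m^{−(2s − 1/2)}`. [folklore] -/
private theorem term_liftSq (f : ℕ → ℂ) (s : ℂ) (m : ℕ) :
    LSeries.term (liftSq f) s (m * m) = LSeries.term f (2 * s - 1 / 2) m := by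
  rcases eq_or_ne m 0 with rfl | hm
  · simp [LSeries.term]
  have hm' : (m : ℂ) ≠ 0 := Nat.cast_ne_zero.mpr hm
  have hmm : m * m ≠ 0 := mul_ne_zero hm hm
  have h1 : (m : ℂ) ^ s ≠ 0 := fun h ↦ hm' ((Complex.cpow_eq_zero_iff _ _).mp h).1
  have h2 : (m : ℂ) ^ ((1 : ℂ) / 2) ≠ 0 := fun h ↦ hm' ((Complex.cpow_eq_zero_iff _ _).mp h).1
  rw [LSeries.term_of_ne_zero hmm, LSeries.term_of_ne_zero hm, liftSq_mul_self,
    natCast_mul_self_cpow, Complex.cpow_sub _ _ hm', cpow_two_mul',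
    ← Complex.ofReal_natCast m, ofReal_sqrt_eq_cpow (Nat.cast_nonneg m), Complex.ofReal_natCast]
  field_simp

/-- Transport helper (analytic bookkeeping for the lift `s ↦ 2s − 1/2`). [folklore] -/
private theorem term_liftSq_eq_zero (f : ℕ → ℂ) (s : ℂ) {n : ℕ}
    (hn : n ∉ Set.range (fun m : ℕ ↦ m * m)) : LSeries.term (liftSq f) s n = 0 := by
  simp [LSeries.term, liftSq_of_not_mem_range hn]

/-- Transport helper (analytic bookkeeping for the lift `s ↦ 2s − 1/2`). [folklore] -/
private theorem mul_self_injective : Function.Injective (fun m : ℕ ↦ m * m) :=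
  fun a b h ↦ (mul_self_inj (Nat.cast_nonneg a : (0 : ℕ) ≤ a) (Nat.zero_le b)).mp h

/-- `∑ (𝓛f)(n) n^{−s}` converges absolutely iff `∑ f(m) m^{−(2s−1/2)}` does. [folklore] -/
private theorem LSeriesSummable_liftSq_iff (f : ℕ → ℂ) (s : ℂ) :
    LSeriesSummable (liftSq f) s ↔ LSeriesSummable f (2 * s - 1 / 2) := by
  rw [LSeriesSummable, LSeriesSummable,
    ← mul_self_injective.summable_iff (fun n hn ↦ term_liftSq_eq_zero f s hn)]
  simp only [Function.comp_def, term_liftSq]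

/-- `∑ (𝓛f)(n) n^{−s} = ∑ f(m) m^{−(2s−1/2)}`. [folklore] -/
private theorem LSeries_liftSq (f : ℕ → ℂ) (s : ℂ) : LSeries (liftSq f) s = LSeries f (2 * s - 1 / 2) := by
  have hsupp : Function.support (LSeries.term (liftSq f) s) ⊆ Set.range (fun m : ℕ ↦ m * m) := by
    intro n hn
    by_contra h
    exact hn (term_liftSq_eq_zero f s h)
  simp only [LSeries]
  rw [← mul_self_injective.tsum_eq hsupp]
  simp only [term_liftSq]

/-- Transport helper (analytic bookkeeping for the lift `s ↦ 2s − 1/2`). [folklore] -/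
private theorem re_twoMulSubHalf (s : ℂ) : (2 * s - 1 / 2 : ℂ).re = 2 * s.re - 1 / 2 := by
  norm_num [Complex.mul_re]

/-- `(𝓛f)` is supported on prime powers if `f` is. [folklore] -/
private theorem liftSq_eq_zero_of_not_isPrimePow {f : ℕ → ℂ} (hf : ∀ n, ¬ IsPrimePow n → f n = 0) {n : ℕ}
    (hn : ¬ IsPrimePow n) : liftSq f n = 0 := by
  by_cases h : Nat.sqrt n * Nat.sqrt n = n
  · have hm : ¬ IsPrimePow (Nat.sqrt n) := by
      intro hp
      apply hn
      rw [← h, ← sq]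
      exact hp.pow two_ne_zero
    simp [liftSq, h, hf _ hm]
  · simp [liftSq, h]

/-- Growth transport: `‖f(m)‖ ≤ C m^a` (`m ≥ 1`) gives `‖(𝓛f)(n)‖ ≤ C n^{a/2 + 1/4}` (`n ≥ 1`). [folklore] -/
private theorem norm_liftSq_le {f : ℕ → ℂ} {C a : ℝ} (hC : 0 ≤ C)
    (hf : ∀ m : ℕ, m ≠ 0 → ‖f m‖ ≤ C * (m : ℝ) ^ a) {n : ℕ} (hn : n ≠ 0) :
    ‖liftSq f n‖ ≤ C * (n : ℝ) ^ (a / 2 + 1 / 4) := by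
  by_cases h : Nat.sqrt n * Nat.sqrt n = n
  · set m := Nat.sqrt n with hm_def
    have hm : m ≠ 0 := by
      rintro h0
      rw [h0, mul_zero] at h
      exact hn h.symm
    have hm0 : (0 : ℝ) < m := by exact_mod_cast Nat.pos_of_ne_zero hm
    have hnm : (n : ℝ) = (m : ℝ) ^ (2 : ℝ) := by
      rw [Real.rpow_two, sq]; exact_mod_cast h.symm
    rw [show liftSq f n = f m * (Real.sqrt m : ℂ) by simp [liftSq, ← hm_def, h], norm_mul,
      Complex.norm_real, Real.norm_of_nonneg (Real.sqrt_nonneg _), Real.sqrt_eq_rpow, hnm,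
      ← Real.rpow_mul hm0.le]
    calc ‖f m‖ * (m : ℝ) ^ (1 / (2 : ℝ)) ≤ C * (m : ℝ) ^ a * (m : ℝ) ^ (1 / (2 : ℝ)) :=
          mul_le_mul_of_nonneg_right (hf m hm) (Real.rpow_nonneg hm0.le _)
      _ = C * (m : ℝ) ^ (2 * (a / 2 + 1 / 4)) := by
          rw [mul_assoc, ← Real.rpow_add hm0]; ring_nf
  · simp only [liftSq, h, if_false, norm_zero]
    positivity

/-- Finite-order transport: `r ≥ 1 ⇒ ‖2s − 1/2‖³ ≤ 27⁴ + ‖s‖⁴`. [folklore] -/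
private theorem norm_twoMulSubHalf_rpow_le (s : ℂ) (hs : 1 ≤ ‖s‖) :
    ‖(2 * s - 1 / 2 : ℂ)‖ ^ (3 : ℝ) ≤ (27 : ℝ) ^ 4 + ‖s‖ ^ (4 : ℝ) := by
  have h3 : ‖(2 * s - 1 / 2 : ℂ)‖ ≤ 3 * ‖s‖ := by
    calc ‖(2 * s - 1 / 2 : ℂ)‖ ≤ ‖(2 : ℂ) * s‖ + ‖(1 / 2 : ℂ)‖ := norm_sub_le _ _
      _ = 2 * ‖s‖ + 1 / 2 := by simp
      _ ≤ 3 * ‖s‖ := by linarith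
  have e3 : ‖(2 * s - 1 / 2 : ℂ)‖ ^ (3 : ℝ) = ‖(2 * s - 1 / 2 : ℂ)‖ ^ (3 : ℕ) := by
    exact_mod_cast Real.rpow_natCast _ 3
  have e4 : ‖s‖ ^ (4 : ℝ) = ‖s‖ ^ (4 : ℕ) := by exact_mod_cast Real.rpow_natCast _ 4
  rw [e3, e4]
  have hcube : ‖(2 * s - 1 / 2 : ℂ)‖ ^ (3 : ℕ) ≤ (3 * ‖s‖) ^ 3 :=
    pow_le_pow_left₀ (norm_nonneg _) h3 3
  have hr : 0 ≤ ‖s‖ := norm_nonneg s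
  rcases le_or_gt ‖s‖ 27 with h27 | h27
  · have : ‖s‖ ^ 3 ≤ (27 : ℝ) ^ 3 := pow_le_pow_left₀ hr h27 3
    nlinarith [pow_nonneg hr 4]
  · have : 27 * ‖s‖ ^ 3 ≤ ‖s‖ ^ 4 := by nlinarith [pow_nonneg hr 3]
    nlinarith

/-- Algebra of the completed function under the lift:
`(c)^{2s−1/2} = c^{−1/2} · (c²)^{s}` for `c > 0`. [folklore] -/
private theorem ofReal_cpow_twoMulSubHalf {c : ℝ} (hc : 0 < c) (s : ℂ) :
    (c : ℂ) ^ (2 * s - 1 / 2) = (c : ℂ) ^ (-(1 / 2 : ℂ)) * (((c ^ 2 : ℝ)) : ℂ) ^ s := by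
  have hc' : (c : ℂ) ≠ 0 := Complex.ofReal_ne_zero.mpr hc.ne'
  rw [show (2 * s - 1 / 2 : ℂ) = -(1 / 2 : ℂ) + 2 * s by ring, Complex.cpow_add _ _ hc',
    cpow_two_mul', sq, Complex.ofReal_mul, Complex.mul_cpow_ofReal_nonneg hc.le hc.le]

/-- The tree's completed product, as a function of `w`. [folklore] -/
private def treePhi (χ : DirichletCharacter ℂ N) (b : ℝ) (w : ℂ) : ℂ :=
  ((((N : ℝ) / π : ℝ)) : ℂ) ^ w *
    (Gamma ((1 / 2 : ℝ) * w + (((1 : ℕ) : ℂ) - b) / 2) * Gamma ((1 / 2 : ℝ) * w + (((1 : ℕ) : ℂ) + b) / 2)) *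
    shiftedL χ b w

/-- The lifted completed function `Φ(s) = ((N/π)²)^s Γ(s + 1/4 − b/2) Γ(s + 1/4 + b/2) Q_{χ,b}(s)`. [folklore] -/
private def liftPhi (χ : DirichletCharacter ℂ N) (b : ℝ) (s : ℂ) : ℂ :=
  (((((N : ℝ) / π) ^ 2 : ℝ)) : ℂ) ^ s *
    (Gamma (((1 : ℝ) : ℂ) * s + (1 / 4 - (b : ℂ) / 2)) * Gamma (((1 : ℝ) : ℂ) * s + (1 / 4 + (b : ℂ) / 2))) *
    weakCarrier χ b s

/-- Transport helper (analytic bookkeeping for the lift `s ↦ 2s − 1/2`). [folklore] -/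
private theorem treePhi_lift (χ : DirichletCharacter ℂ N) (b : ℝ) (s : ℂ) :
    treePhi χ b (2 * s - 1 / 2) = ((((N : ℝ) / π : ℝ)) : ℂ) ^ (-(1 / 2 : ℂ)) * liftPhi χ b s := by
  have hc : (0 : ℝ) < N / π :=
    div_pos (by exact_mod_cast Nat.pos_of_ne_zero (NeZero.ne N)) Real.pi_pos
  have e1 : ((1 / 2 : ℝ) : ℂ) * (2 * s - 1 / 2) + (((1 : ℕ) : ℂ) - (b : ℂ)) / 2 =
      ((1 : ℝ) : ℂ) * s + (1 / 4 - (b : ℂ) / 2) := by push_cast; ring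
  have e2 : ((1 / 2 : ℝ) : ℂ) * (2 * s - 1 / 2) + (((1 : ℕ) : ℂ) + (b : ℂ)) / 2 =
      ((1 : ℝ) : ℂ) * s + (1 / 4 + (b : ℂ) / 2) := by push_cast; ring
  rw [treePhi, e1, e2, ofReal_cpow_twoMulSubHalf hc, liftPhi, weakCarrier, quadLift]
  ring

/-- Transport helper (analytic bookkeeping for the lift `s ↦ 2s − 1/2`). [folklore] -/
private theorem conj_twoMulSubHalf (s : ℂ) : 1 - conj (2 * s - 1 / 2 : ℂ) = 2 * (1 - conj s) - 1 / 2 := by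
  simp only [map_sub, map_mul, map_div₀, map_one, map_ofNat]
  ring

/-- **Functional equation of the lift** on the strip `1/4 + b/2 < σ < 3/4 − b/2`
(`ω = 1`, Selberg's conjugate form), from the tree's `shiftedL_functional_equation`. [folklore] -/
private theorem liftPhi_functional_equation {χ : DirichletCharacter ℂ N} (hprim : χ.IsPrimitive) (hN : N ≠ 1)
    (hreal : χ⁻¹ = χ) (hodd : χ.Odd) {b : ℝ} (hb0 : 0 < b) {s : ℂ}
    (h₁ : 1 / 4 + b / 2 < s.re) (h₂ : s.re < 3 / 4 - b / 2) :
    liftPhi χ b s = conj (liftPhi χ b (1 - conj s)) := by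
  have hgf : ∀ w, DirichletCharacter.gammaFactor χ w = Gammaℝ (w + (1 : ℕ)) := fun w ↦ by
    rw [hodd.gammaFactor_def, Nat.cast_one]
  have habs : |b| = b := abs_of_pos hb0
  have hw₁ : |b| < (2 * s - 1 / 2 : ℂ).re := by rw [habs, re_twoMulSubHalf]; linarith
  have hw₂ : (2 * s - 1 / 2 : ℂ).re < 1 - |b| := by rw [habs, re_twoMulSubHalf]; linarith
  have key : treePhi χ b (2 * s - 1 / 2) = 1 * conj (treePhi χ b (1 - conj (2 * s - 1 / 2))) :=
    shiftedL_functional_equation hprim hN hreal 1 hgf hw₁ hw₂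
  rw [conj_twoMulSubHalf, treePhi_lift, treePhi_lift, one_mul, map_mul] at key
  have hc : (0 : ℝ) < N / π :=
    div_pos (by exact_mod_cast Nat.pos_of_ne_zero (NeZero.ne N)) Real.pi_pos
  have hreal' : conj (((((N : ℝ) / π : ℝ)) : ℂ) ^ (-(1 / 2 : ℂ))) =
      ((((N : ℝ) / π : ℝ)) : ℂ) ^ (-(1 / 2 : ℂ)) := by
    rw [show (-(1 / 2 : ℂ)) = ((-(1 / 2 : ℝ) : ℝ) : ℂ) by push_cast; ring,
      ← Complex.ofReal_cpow hc.le, Complex.conj_ofReal]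
  rw [hreal'] at key
  have hne : ((((N : ℝ) / π : ℝ)) : ℂ) ^ (-(1 / 2 : ℂ)) ≠ 0 := fun h ↦
    (Complex.ofReal_ne_zero.mpr hc.ne') ((Complex.cpow_eq_zero_iff _ _).mp h).1
  exact mul_left_cancel₀ hne key

/-- **PART B main: `Q_{χ,b}` IS a weak-Ramanujan datum** (χ odd, real, primitive mod `N ≠ 1`,
`0 < b < 1/2`): coefficients `liftSq c_{χ,b}`, abscissa `3/4 + b/2`, polar `1`, `Q = (N/π)²`, gamma
factors `Γ(s + 1/4 ∓ b/2)`, `ω = 1`, FE on `1/4 + b/2 < σ < 3/4 − b/2`, Selberg's (5) with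
`b = liftSq b_{χ,b}`, `θ = 1/4 + b/2 < 1/2`. Of Selberg's axioms exactly (4) fails. [cite: KaczorowskiSelbergClass2006, §2.1 axioms (1)–(5), p. 156] -/
theorem weakCarrierDatum_holds {χ : DirichletCharacter ℂ N} (hprim : χ.IsPrimitive) (hN : N ≠ 1)
    (hreal : χ⁻¹ = χ) (hodd : χ.Odd) {b : ℝ} (hb0 : 0 < b) (hb : b < 1 / 2) :
    WeakCarrierDatum χ b := by
  have hχ : χ ≠ 1 := SelbergDirichlet.ne_one_of_isPrimitive hN hprim
  obtain ⟨A, hA, hAB⟩ := exists_norm_shiftedL_le hprim hN hb0.le (by linarith)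
  have hNpos : (0 : ℝ) < N := by exact_mod_cast Nat.pos_of_ne_zero (NeZero.ne N)
  have hw : ∀ s : ℂ, 3 / 4 + b / 2 < s.re → 1 + b < (2 * s - 1 / 2 : ℂ).re := fun s hs ↦ by
    rw [re_twoMulSubHalf]; linarith
  refine ⟨{ coeff := weakCarrierCoeff χ b
            toFun := weakCarrier χ b
            abscissa := 3 / 4 + b / 2
            polar := 1
            Q := ((N : ℝ) / π) ^ 2
            numGamma := 2
            lam := fun _ ↦ 1
            mu := ![1 / 4 - (b : ℂ) / 2, 1 / 4 + (b : ℂ) / 2]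
            rootNumber := 1
            coeff_one := ?_
            summable := fun s hs ↦
              (LSeriesSummable_liftSq_iff _ s).mpr (LSeriesSummable_shiftedLCoeff χ hb0.le (hw s hs))
            eqOn_LSeries := fun s hs ↦ by
              rw [weakCarrierCoeff, LSeries_liftSq, LSeries_shiftedLCoeff χ hb0.le (hw s hs)]
              rfl
            polar_ne_zero := one_ne_zero
            differentiable := ⟨weakCarrier χ b,
              (differentiable_shiftedL hχ b).comp ((differentiable_id.const_mul (2 : ℂ)).sub_const _),
              fun s _ ↦ by simp⟩
            finiteOrder := ⟨A * Real.exp ((27 : ℝ) ^ 4), 4, fun s _ hs ↦ ?_⟩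
            Q_pos := by positivity
            lam_pos := fun _ ↦ by norm_num
            norm_rootNumber := norm_one
            functional_equation := ⟨1 / 4 + b / 2, 3 / 4 - b / 2, by linarith, fun s h₁ h₂ ↦ ?_⟩
            euler_product := ⟨liftSq (shiftedLLogCoeff χ b), 1 / 4 + b / 2, by linarith,
              fun n hn ↦ liftSq_eq_zero_of_not_isPrimePow (fun m hm ↦ shiftedLLogCoeff_eq_zero χ hm) hn,
              ?_, fun s hs ↦ by
                rw [LSeries_liftSq]
                exact exp_LSeries_shiftedLLogCoeff χ hb0.le (hw s hs)⟩ },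
    rfl, rfl, rfl, rfl, rfl, rfl, rfl, fun _ ↦ rfl, fun j ↦ ?_⟩
  · -- `a(1) = 1`
    have h := liftSq_mul_self (⇑(shiftedLCoeff χ b)) 1
    rw [mul_one] at h
    rw [weakCarrierCoeff, h, shiftedLCoeff_one]
    simp
  · -- finite order
    have h1 := hAB (2 * s - 1 / 2)
    have h2 := norm_twoMulSubHalf_rpow_le s hs
    simp only [Polynomial.eval_one, one_mul]
    calc ‖weakCarrier χ b s‖ = ‖shiftedL χ b (2 * s - 1 / 2)‖ := rfl
      _ ≤ A * Real.exp (‖(2 * s - 1 / 2 : ℂ)‖ ^ (3 : ℝ)) := h1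
      _ ≤ A * Real.exp ((27 : ℝ) ^ 4 + ‖s‖ ^ (4 : ℝ)) := by gcongr
      _ = A * Real.exp ((27 : ℝ) ^ 4) * Real.exp (‖s‖ ^ (4 : ℝ)) := by rw [Real.exp_add, mul_assoc]
  · -- functional equation
    have key := liftPhi_functional_equation hprim hN hreal hodd hb0 h₁ h₂
    simp only [Fin.prod_univ_two, Matrix.cons_val_zero, Matrix.cons_val_one, one_mul]
    simpa [liftPhi] using key
  · -- `b(n) ≪ n^{1/4 + b/2}`
    refine IsBigO.of_bound 2 ?_
    filter_upwards [eventually_ne_atTop 0] with n hn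
    rw [Real.norm_of_nonneg (Real.rpow_nonneg (Nat.cast_nonneg n) _),
      show (1 / 4 + b / 2 : ℝ) = b / 2 + 1 / 4 by ring]
    exact norm_liftSq_le zero_le_two (fun m hm ↦ norm_shiftedLLogCoeff_le χ hb0.le hm) hn
  · -- `re μ_j = 1/4 ∓ b/2 ≥ 0`
    fin_cases j <;> simp <;> linarith

/-- **Caveat (a) closes NEGATIVELY**: for `χ` odd, real, primitive mod `N ≠ 1` with ONE critical-line
zero of `L(s, χ)` and any `0 < b < 1/2`, the weak-Ramanujan class does not force the strip RH. [cite: Rumely1993ERH, Table] -/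
theorem not_weakRamanujanClassForcesLine {χ : DirichletCharacter ℂ N} (hprim : χ.IsPrimitive)
    (hN : N ≠ 1) (hreal : χ⁻¹ = χ) (hodd : χ.Odd) {b : ℝ} (hb0 : 0 < b) (hb : b < 1 / 2)
    (hz : ∃ t : ℝ, χ.LFunction (1 / 2 + t * I) = 0) : ¬ WeakRamanujanClassForcesLine :=
  not_weakRamanujanClassForcesLine_of (SelbergDirichlet.ne_one_of_isPrimitive hN hprim) hb0 hb
    (weakCarrierDatum_holds hprim hN hreal hodd hb0 hb) hz

/-- Census shape: a weak-Ramanujan datum with a zero `s`, `0 < re s < 1`, `re s ≠ 1/2`. [cite: Rumely1993ERH, Table] -/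
theorem exists_weakRamanujan_offLine {χ : DirichletCharacter ℂ N} (hprim : χ.IsPrimitive)
    (hN : N ≠ 1) (hreal : χ⁻¹ = χ) (hodd : χ.Odd) {b : ℝ} (hb0 : 0 < b) (hb : b < 1 / 2)
    (hz : ∃ t : ℝ, χ.LFunction (1 / 2 + t * I) = 0) :
    ∃ (D : NontemperedSelbergDatum) (s : ℂ), WeakRamanujanClass D ∧ D.toFun = weakCarrier χ b ∧
      D.toFun s = 0 ∧ 0 < s.re ∧ s.re < 1 ∧ s.re ≠ 1 / 2 := by
  have hχ : χ ≠ 1 := SelbergDirichlet.ne_one_of_isPrimitive hN hprim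
  obtain ⟨D, hF, -, habs, hpol, -, -, -, -, hmu⟩ := weakCarrierDatum_holds hprim hN hreal hodd hb0 hb
  obtain ⟨t, ht⟩ := hz
  refine ⟨D, 1 / 2 + b / 2 + t / 2 * I, ⟨?_, ⟨0, ?_⟩, hmu⟩, hF, ?_, ?_, ?_, ?_⟩
  · rw [habs]; linarith
  · rw [hpol, pow_zero]
  · rw [hF]; exact weakCarrier_eq_zero hN hχ b ht
  · simp; linarith
  · simp; linarith
  · simp; linarith

/-! ## PART C · the polynomial Euler product (5), local degree 4, defect `1/4 + b/2` -/

/-- Polynomial Euler product of local degree `≤ d` with Ramanujan defect `θ`: local roots `β_{p,i}`,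
`‖β_{p,i}‖ ≤ p^θ`, `F(s) = ∏_p ∏_i (1 − β_{p,i} p^{−s})^{−1}` on `re s > abscissa`. [cite: KaczorowskiSelbergClass2006, §2.1 axioms (1)–(5), p. 156] -/
def IsPolyEuler (D : NontemperedSelbergDatum) (d : ℕ) (θ : ℝ) : Prop :=
  ∃ β : ℕ → Fin d → ℂ, (∀ p : ℕ, p.Prime → ∀ i, ‖β p i‖ ≤ (p : ℝ) ^ θ) ∧
    ∀ s : ℂ, D.abscissa < s.re →
      HasProd (fun p : Nat.Primes ↦ ∏ i, (1 - β p i * (p : ℂ) ^ (-s))⁻¹) (D.toFun s)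

/-- (MAP §1 (5)) `Q_{χ,b}` has a POLYNOMIAL Euler product of local degree 4,
`(1 − χ(p)p^{1/2+b}X²)^{−1}(1 − χ̄(p)p^{1/2−b}X²)^{−1}`, defect `1/4 + b/2` — PROVED below
(`weakCarrierPolyEuler`, from Mathlib's Euler product for Dirichlet L-series). [cite: KaczorowskiSelbergClass2006, §2.1 axioms (1)–(5), p. 156] -/
def WeakCarrierPolyEuler (χ : DirichletCharacter ℂ N) (b : ℝ) : Prop :=
  ∀ D : NontemperedSelbergDatum, D.toFun = weakCarrier χ b → D.abscissa = 3 / 4 + b / 2 →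
    IsPolyEuler D 4 (1 / 4 + b / 2)

omit [NeZero N] in
/-- Norm of a square root of `χ(p) p^{c}`: `≤ p^{c/2}`. [folklore] -/
private theorem norm_localRoot_le (χ : DirichletCharacter ℂ N) {p : ℕ} (hp : p.Prime) (c : ℝ) :
    ‖(χ p * (p : ℂ) ^ (c : ℂ)) ^ (((1 / 2 : ℝ)) : ℂ)‖ ≤ (p : ℝ) ^ (c / 2) := by
  have hp0 : (0 : ℝ) < p := by exact_mod_cast hp.pos
  rw [Complex.norm_cpow_real, norm_mul, ← Complex.ofReal_natCast,
    Complex.norm_cpow_eq_rpow_re_of_pos hp0, Complex.ofReal_re,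
    show c / 2 = c * (1 / 2) by ring, Real.rpow_mul hp0.le]
  gcongr
  calc ‖χ p‖ * (p : ℝ) ^ c ≤ 1 * (p : ℝ) ^ c := by
        gcongr; exact DirichletCharacter.norm_le_one χ _
    _ = (p : ℝ) ^ c := one_mul _

/-- Transport helper (analytic bookkeeping for the lift `s ↦ 2s − 1/2`). [folklore] -/
private theorem localRoot_sq (z : ℂ) : (z ^ (((1 / 2 : ℝ)) : ℂ)) ^ 2 = z := by
  rw [← Complex.cpow_nat_mul]
  push_cast
  norm_num

/-- Transport helper (analytic bookkeeping for the lift `s ↦ 2s − 1/2`). [folklore] -/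
private theorem two_localFactors (r X : ℂ) :
    (1 - r * X)⁻¹ * (1 - (-r) * X)⁻¹ = (1 - r ^ 2 * X ^ 2)⁻¹ := by
  rw [← mul_inv]
  congr 1
  ring

/-- **OWED-1b discharged: `Q_{χ,b}` has a POLYNOMIAL Euler product of local degree 4 and defect
`1/4 + b/2`** — local roots `±(χ(p)p^{1/2+b})^{1/2}, ±(χ̄(p)p^{1/2−b})^{1/2}`, from Mathlib's Euler
product for Dirichlet L-series at `w = 2s − 1/2 ∓ b`. [cite: KaczorowskiSelbergClass2006, §2.1 axioms (1)–(5), p. 156] -/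
theorem weakCarrierPolyEuler (χ : DirichletCharacter ℂ N) {b : ℝ} (hb0 : 0 ≤ b) :
    WeakCarrierPolyEuler χ b := by
  intro D hD habs
  set r₁ : ℕ → ℂ := fun p ↦ (χ p * (p : ℂ) ^ (((1 / 2 + b : ℝ)) : ℂ)) ^ (((1 / 2 : ℝ)) : ℂ) with hr₁
  set r₂ : ℕ → ℂ := fun p ↦ (χ⁻¹ p * (p : ℂ) ^ (((1 / 2 - b : ℝ)) : ℂ)) ^ (((1 / 2 : ℝ)) : ℂ) with hr₂
  refine ⟨fun p ↦ ![r₁ p, -r₁ p, r₂ p, -r₂ p], fun p hp i ↦ ?_, fun s hs ↦ ?_⟩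
  · have hp1 : (1 : ℝ) ≤ p := by exact_mod_cast hp.one_lt.le
    have h1 : ‖r₁ p‖ ≤ (p : ℝ) ^ (1 / 4 + b / 2) := by
      have := norm_localRoot_le χ hp (1 / 2 + b)
      rwa [show (1 / 2 + b) / 2 = 1 / 4 + b / 2 by ring] at this
    have h2 : ‖r₂ p‖ ≤ (p : ℝ) ^ (1 / 4 + b / 2) := by
      have := norm_localRoot_le χ⁻¹ hp (1 / 2 - b)
      rw [show (1 / 2 - b) / 2 = 1 / 4 - b / 2 by ring] at this
      exact this.trans (Real.rpow_le_rpow_of_exponent_le hp1 (by linarith))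
    fin_cases i
    · simpa using h1
    · simpa using h1
    · simpa using h2
    · simpa using h2
  · rw [habs] at hs
    have hw₁ : 1 < (2 * s - 1 / 2 - (b : ℂ)).re := by norm_num [Complex.mul_re]; linarith
    have hw₂ : 1 < (2 * s - 1 / 2 + (b : ℂ)).re := by norm_num [Complex.mul_re]; linarith
    have key := (DirichletCharacter.LSeries_eulerProduct_hasProd χ hw₁).mul
      (DirichletCharacter.LSeries_eulerProduct_hasProd χ⁻¹ hw₂)
    rw [hD, weakCarrier_apply, DirichletCharacter.LFunction_eq_LSeries χ hw₁,
      DirichletCharacter.LFunction_eq_LSeries χ⁻¹ hw₂]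
    convert key using 2 with p
    have hp0 : (p : ℂ) ≠ 0 := Nat.cast_ne_zero.mpr p.prop.ne_zero
    have hX : ((p : ℂ) ^ (-s)) ^ 2 = (p : ℂ) ^ (2 * -s) := (Complex.cpow_nat_mul _ 2 _).symm
    rw [Fin.prod_univ_four]
    simp only [Matrix.cons_val_zero, Matrix.cons_val_one, Matrix.cons_val]
    rw [mul_assoc, two_localFactors, two_localFactors, hr₁, hr₂, localRoot_sq, localRoot_sq, hX,
      mul_assoc, ← Complex.cpow_add _ _ hp0, mul_assoc, ← Complex.cpow_add _ _ hp0]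
    congr 3
    · push_cast; ring
    · push_cast; ring

end Literature.Barriers.RiemannHypothesis.RamanujanAxiom.WeakCarrier
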